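import Summits.QuantumFields.BalabanUV.Beta.CombMixedT2EvenStoreyTorus

/-!
# `BalabanUV.Beta.CombHessStoreySplitTorus` — binder row D1 ∕ (C1), PART 34: **ROAD FP's Ĉ-SPLIT — THE PERIODISED COMPOSITE CONSTRAINT HESSIAN SPLITS STOREYWISE ON THE
# TORUS, EVERY DEPTH**: `(perF M (dper M (compH ρ_c Lc (m+1) β.1 β.2)))|ff = Σ_{b₁,b₂ ∈ win β} h(β;b₁,b₂) • (cL̃_m(b₁) ⊗ cL̃_m(b₂)) + Σ_{b ∈ win β} ℓ(β;b) • (perF M (dper M (compH ρ_c Lc m b.1 b.2)))|ff`,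
# and at depth 2 in PART 31d's letters `Ĉ_β = Σ_{b₁b₂} h(β;b₁,b₂) • vecMulVec ℓ̃_{b₁} ℓ̃_{b₂} + Σ_b ℓ(β;b) • Ĥ_b` — the ONE LETTER road FP g47 asked for (W-1, journal l.68082) so that
# `FP/TowerK2bStoreyBridge` turns PART 31∕33's storeywise row into v6's displayed `hK2b` shape with the explicit transport-variation remainder `Rs`

WHY (road FP g47 W-1 [D1P3-G47-ONLINE] l.68082: «Ĉ-SPLIT on the torus at depth m+1 in PART 31d∕32's letters (say if it is already F6a″∕`compH_succ` periodised — then just name it)»).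
It is F6a's top peel `CompositeVertexKernelRec.compVHKer_succ` (`compH = compHessFF = packFF compVHKer`, F6a∕F6d) read under `perZ M ∘ dper M` — both are DEFINITIONAL period sums
(`perZ_apply`, `dper_apply`: `perZ M (dper M K) x z = Σ'_k Σ'_n K (x+M∘n) (z+M∘k+M∘n)`), so no period hypothesis on `M` and no copy sum is involved — and folded by PART 33b's
`tsum_tsum_storeyWords_succ_eq` (the top word is rank-one in the two `m`-fold transports, the lower word is the window bond's depth-`m` composite Hessian; every piece is supported in
the depth-(m+1) window of `β` in each fluctuation site by F6a `compVHKer_eq_zero_left∕right` + `mem_winF_succ_of_offs`).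

WHAT (`d = 3`, centred root `ρ_c = ctr 4 Lc = toSite (ctrOff 4 Lc)`; [folklore] `tsum`∕`Matrix` bookkeeping BY NAME; no `def`, no `def … : Prop`, nothing cited, 0 sorry):
**`perZ_dper_compH_succ_inl_inl`** (entrywise, every depth, any `M`), **`perF_dper_compH_succ_ff`** (matrix form on the `ff` block), **`perF_dper_compH_two_ff`** (depth 2 in 31d's
letters: `compLin_1 = ℓ` by `compLinKer_one`, `compH_1 = symHessFFAt ρ_c Lc` by F6d `compH_one`).  In the tower: `(tabsComp (n+2) hLc (Roots.ctr Lc).hr cM).H = compH (ctrOff 4 Lc) Lc (n+2)`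
by `tabsComp_H ∕ Roots.ctr_r` (`rfl`).
WHAT THIS IS NOT: not the bridge to v6's `hK2b` shape (road `FP/TowerK2bStoreyBridge`); not (J-R₂); nothing of Bałaban's asserted, valued or discharged; 0 estimates; 0∕4 row-D1 binders
(hW, hR, D1Tel, D1Rep); ROOT M‴ p325680 ∕ P5c ∕ D6 untouched; NOT (C1), NOT (T-ID), NOT D1, NEVER «G-an2-4 closed», NOT BetaPertH, NOT continuum, NOT Clay.

HONEST DEPENDENCY (page 1, mandatory): continuum YM on T⁴ ⇐ BetaPertH ∧ nine spine estimates (0/9 proved); BetaPertH ⇐ (D1) ∧ (D4) ∧ CAP+tail;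
G-an2-4 gates asym, D1 and NE2/3/4.  HONEST FRAMING (cell contract, verbatim): «discharging `BetaPertH` makes Bałaban's UV stability UNCONDITIONAL —
a real constructive-QFT result; it is NOT the continuum limit and NOT the Clay problem.»  ABSOLUTE RULE (cell charter, verbatim): «No internally-minted
statement may enter as a cited fact. Every hypothesis is either kernel-proved in this package or a verbatim quotation of a PUBLISHED theorem with page
reference. The manuscript(s) under audit are NOT citable for their own disputed steps — they are the thing under adjudication; programme-internal
(2001/route/tribunal) claims are never citable.»  Row D1 ∕ (C1) OWNER an2 (b2b-balaban-beta-an2) gen 71, 2026-08-28.  No existing file touched.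
-/

noncomputable section

open scoped BigOperators

namespace Summit.QuantumFields.BalabanUV.Beta.CombHessStoreySplitTorus

open Finset Matrix
open Literature.MathematicalPhysics.QuantumFieldTheory
open Literature.MathematicalPhysics.QuantumFieldTheory.Balaban1983to89
open Literature.MathematicalPhysics.QuantumFieldTheory.Balaban1983to89.Beta
open B4TorusKernel.MultiPeriod (translate)
open B6Lemma24Torus (pbox)
open ExpKernelCalculus (MKer)
open AffineAveraging (Site box toSite)
open AveragingContoursRooted (ctr ctrOff ctrOff_mem_box)
open AveragingHessianKernels (Bond)
open OneStepResolventKernel (Fib)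
open Summit.QuantumFields.BalabanUV.Beta.AxialDressingRooted (one_le_of_neZero)
open Summit.QuantumFields.BalabanUV.Beta.SymAveragingHessianCounts (symLinKerAt symHessKerAt symHessFFAt)
open Summit.QuantumFields.BalabanUV.Beta.CompositeVertexKernelRec (offs winF wid compLinKer compVHKer compVHKer_succ compVHKer_eq_zero_left compVHKer_eq_zero_right compLinKer_one
  mem_winF_succ_of_offs)
open Summit.QuantumFields.BalabanUV.Beta.CompositeHessianTable (compHessFF packFF_inl_inl)
open Summit.QuantumFields.BalabanUV.Beta.CompositeOneShotJets (compH compH_one)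
open Summit.QuantumFields.BalabanUV.Beta.CombMixedT2EvenStoreyTwoLetters (symLin_off)
open Summit.QuantumFields.BalabanUV.Beta.FP.KernelPeriodisationFib (Idx perF perF_apply perZ perZ_apply)
open Summit.QuantumFields.BalabanUV.Beta.FP.KernelPeriodisationFibLoc (dper dper_apply)
open Summit.QuantumFields.BalabanUV.Beta.CombMixedT2EvenStoreyTorus (tsum_tsum_storeyWords_succ_eq)

variable {Lc : ℕ} [NeZero Lc]

/-! ## §6 Road FP's Ĉ-SPLIT: the periodised composite constraint Hessian splits storeywise on the torus, every depth -/

section Split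

variable (M : Fin (3 + 1) → ℕ) [∀ μ, NeZero (M μ)] (m : ℕ) (ρ' : Fin (3 + 1)) (w : Site (3 + 1))

omit [NeZero Lc] in
/-- [folklore] **`perZ_dper_compH_succ_inl_inl` — Ĉ-SPLIT, ENTRYWISE, EVERY DEPTH**: the fine-torus periodisation of the depth-(m+1) composite constraint Hessian at a coarse bond
`β = (ρ′, w)` splits into its two storeys,
`perZ M (dper M (compH ρ_c Lc (m+1) ρ′ w)) x z (inl α) (inl γ) = Σ_{b₁,b₂ ∈ win β} h(β;b₁,b₂)·cL̃_m((α,x);b₁)·cL̃_m((γ,z);b₂) + Σ_{b ∈ win β} ℓ(β;b)·perZ M (dper M (compH ρ_c Lc m b.1 b.2)) x z (inl α) (inl γ)`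
(`cL̃_m((α,x);b) := Σ'_n compLin_m((α, x+M∘n); b)`) — F6a's top peel `compVHKer_succ` under `perZ ∘ dper` (both definitional period sums), folded by PART 33b's
`tsum_tsum_storeyWords_succ_eq` (every piece is supported in the depth-(m+1) window of `β` in each fluctuation site).  No period hypothesis on `M` is needed. -/
theorem perZ_dper_compH_succ_inl_inl (x z : Site (3 + 1)) (α γ : Fin (3 + 1)) :
    perZ M (dper M (compH (ctrOff (3 + 1) Lc) Lc (m + 1) ρ' w)) x z (Sum.inl α) (Sum.inl γ)
      = (∑ κ₁ : Fin (3 + 1), ∑ e₁ ∈ offs Lc, ∑ κ₂ : Fin (3 + 1), ∑ e₂ ∈ offs Lc,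
          symHessKerAt (ctr 4 Lc) Lc ρ' w (κ₁, (Lc : ℤ) • w + e₁) (κ₂, (Lc : ℤ) • w + e₂)
            * (∑' n : Site (3 + 1), compLinKer (fun _ => symLinKerAt (ctr 4 Lc) Lc) Lc m (α, translate M x n) (κ₁, (Lc : ℤ) • w + e₁))
            * (∑' n : Site (3 + 1), compLinKer (fun _ => symLinKerAt (ctr 4 Lc) Lc) Lc m (γ, translate M z n) (κ₂, (Lc : ℤ) • w + e₂)))
        + ∑ κ : Fin (3 + 1), ∑ e ∈ offs Lc, symLinKerAt (ctr 4 Lc) Lc ρ' w (κ, (Lc : ℤ) • w + e)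
            * perZ M (dper M (compH (ctrOff (3 + 1) Lc) Lc m κ ((Lc : ℤ) • w + e))) x z (Sum.inl α) (Sum.inl γ) := by
  -- both period sums are definitional; the depth-(m+1) entry is F6a's top peel
  have hentry : ∀ x' z' : Site (3 + 1), compH (ctrOff (3 + 1) Lc) Lc (m + 1) ρ' w x' z' (Sum.inl α) (Sum.inl γ)
      = 1 * (∑ κ₁ : Fin (3 + 1), ∑ e₁ ∈ offs Lc, ∑ κ₂ : Fin (3 + 1), ∑ e₂ ∈ offs Lc,
          (fun _ _ : Site (3 + 1) => (1 : ℝ)) e₁ e₂ * symHessKerAt (ctr 4 Lc) Lc ρ' w (κ₁, (Lc : ℤ) • w + e₁) (κ₂, (Lc : ℤ) • w + e₂)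
            * compLinKer (fun _ => symLinKerAt (ctr 4 Lc) Lc) Lc m (α, x') (κ₁, (Lc : ℤ) • w + e₁)
            * compLinKer (fun _ => symLinKerAt (ctr 4 Lc) Lc) Lc m (γ, z') (κ₂, (Lc : ℤ) • w + e₂))
        + ∑ κ : Fin (3 + 1), ∑ e ∈ offs Lc, symLinKerAt (ctr 4 Lc) Lc ρ' w (κ, (Lc : ℤ) • w + e)
            * compVHKer (fun _ => symLinKerAt (ctr 4 Lc) Lc) (fun _ => symHessKerAt (ctr 4 Lc) Lc) Lc m κ ((Lc : ℤ) • w + e) (α, x') (γ, z') := fun x' z' => by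
    simp only [compH, compHessFF, packFF_inl_inl, compVHKer_succ, one_mul]
    rfl
  have hlow : ∀ (κ : Fin (3 + 1)) (e : Site (3 + 1)), perZ M (dper M (compH (ctrOff (3 + 1) Lc) Lc m κ ((Lc : ℤ) • w + e))) x z (Sum.inl α) (Sum.inl γ)
      = ∑' k : Site (3 + 1), ∑' n : Site (3 + 1), compVHKer (fun _ => symLinKerAt (ctr 4 Lc) Lc) (fun _ => symHessKerAt (ctr 4 Lc) Lc) Lc m κ ((Lc : ℤ) • w + e)
          (α, translate M x n) (γ, translate M (translate M z k) n) := fun κ e => by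
    simp only [perZ_apply, dper_apply, compH, compHessFF, packFF_inl_inl]
    rfl
  simp only [hlow]
  simp only [perZ_apply, dper_apply, hentry]
  rw [tsum_tsum_storeyWords_succ_eq (Lc := Lc) (M := M) m ρ' w (fun _ _ => (1 : ℝ)) 1
      (fun κ e x' z' => compVHKer (fun _ => symLinKerAt (ctr 4 Lc) Lc) (fun _ => symHessKerAt (ctr 4 Lc) Lc) Lc m κ ((Lc : ℤ) • w + e) (α, x') (γ, z'))
      (fun κ e he x' z' hx' => compVHKer_eq_zero_left m (f := (α, x')) (γ, z') fun h => hx' (mem_winF_succ_of_offs he h))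
      (fun κ e he x' z' hz' => compVHKer_eq_zero_right m (α, x') (f' := (γ, z')) fun h => hz' (mem_winF_succ_of_offs he h)) x z α γ,
    one_mul]
  simp only [one_mul]

omit [NeZero Lc] in
/-- [folklore] **`perF_dper_compH_succ_ff` — Ĉ-SPLIT AS A MATRIX IDENTITY ON THE `ff` BLOCK, EVERY DEPTH** (road FP g47 W-1's letter, `TowerHN2RowMixedWard`'s
`Ĉ_β := (perF M (dper M ((tabsComp (m+1) …).H β.2 ↑β.1)))|ff` with `(tabsComp …).H = compH ρ_c Lc (m+1)` by `tabsComp_H`):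
`Ĉ_β = Σ_{b₁,b₂ ∈ win β} h(β;b₁,b₂) • (cL̃_m(b₁) ⊗ cL̃_m(b₂)) + Σ_{b ∈ win β} ℓ(β;b) • Ĉ⁽ᵐ⁾_b`, `Ĉ⁽ᵐ⁾_b := (perF M (dper M (compH ρ_c Lc m b.1 b.2)))|ff`. -/
theorem perF_dper_compH_succ_ff :
    (perF M (dper M (compH (ctrOff (3 + 1) Lc) Lc (m + 1) ρ' w))).submatrix
        (fun b : ↥(pbox M) × Fin (3 + 1) => ((b.1, Sum.inl b.2) : Idx M (Fib 3)))
        (fun b : ↥(pbox M) × Fin (3 + 1) => ((b.1, Sum.inl b.2) : Idx M (Fib 3)))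
      = (∑ κ₁ : Fin (3 + 1), ∑ e₁ ∈ offs Lc, ∑ κ₂ : Fin (3 + 1), ∑ e₂ ∈ offs Lc,
          symHessKerAt (ctr 4 Lc) Lc ρ' w (κ₁, (Lc : ℤ) • w + e₁) (κ₂, (Lc : ℤ) • w + e₂)
            • Matrix.vecMulVec
                (fun f : ↥(pbox M) × Fin (3 + 1) => ∑' n : Site (3 + 1),
                  compLinKer (fun _ => symLinKerAt (ctr 4 Lc) Lc) Lc m (f.2, translate M (f.1 : Site (3 + 1)) n) (κ₁, (Lc : ℤ) • w + e₁))
                (fun f : ↥(pbox M) × Fin (3 + 1) => ∑' n : Site (3 + 1),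
                  compLinKer (fun _ => symLinKerAt (ctr 4 Lc) Lc) Lc m (f.2, translate M (f.1 : Site (3 + 1)) n) (κ₂, (Lc : ℤ) • w + e₂)))
        + ∑ κ : Fin (3 + 1), ∑ e ∈ offs Lc, symLinKerAt (ctr 4 Lc) Lc ρ' w (κ, (Lc : ℤ) • w + e)
            • (perF M (dper M (compH (ctrOff (3 + 1) Lc) Lc m κ ((Lc : ℤ) • w + e)))).submatrix
                (fun b : ↥(pbox M) × Fin (3 + 1) => ((b.1, Sum.inl b.2) : Idx M (Fib 3)))
                (fun b : ↥(pbox M) × Fin (3 + 1) => ((b.1, Sum.inl b.2) : Idx M (Fib 3))) := by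
  ext f f'
  simp only [Matrix.submatrix_apply, Matrix.add_apply, Matrix.sum_apply, Matrix.smul_apply, Matrix.vecMulVec_apply, perF_apply, smul_eq_mul]
  rw [perZ_dper_compH_succ_inl_inl M m ρ' w _ _ f.2 f'.2]
  refine congrArg₂ (· + ·) ?_ rfl
  exact Finset.sum_congr rfl fun κ₁ _ => Finset.sum_congr rfl fun e₁ _ => Finset.sum_congr rfl fun κ₂ _ => Finset.sum_congr rfl fun e₂ _ => by ring

/-- [folklore] **`perF_dper_compH_two_ff` — Ĉ-SPLIT AT DEPTH 2 IN PART 31d's LETTERS** (road FP g47 W-1 verbatim): with `ℓ̃_b f := Σ'_n ℓ(b;(f.2, ↑f.1 + M∘n))` and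
`Ĥ_b := (perF M (dper M (symHessFFAt ρ_c Lc b.1 b.2)))|ff`,
`(perF M (dper M (compH ρ_c Lc 2 ρ′ w)))|ff = Σ_{b₁,b₂ ∈ win β} h(β;b₁,b₂) • vecMulVec ℓ̃_{b₁} ℓ̃_{b₂} + Σ_{b ∈ win β} ℓ(β;b) • Ĥ_b` (`compLin_1 = ℓ`, `compH_1 = symHessFFAt`). -/
theorem perF_dper_compH_two_ff :
    (perF M (dper M (compH (ctrOff (3 + 1) Lc) Lc 2 ρ' w))).submatrix
        (fun b : ↥(pbox M) × Fin (3 + 1) => ((b.1, Sum.inl b.2) : Idx M (Fib 3)))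
        (fun b : ↥(pbox M) × Fin (3 + 1) => ((b.1, Sum.inl b.2) : Idx M (Fib 3)))
      = (∑ κ₁ : Fin (3 + 1), ∑ e₁ ∈ offs Lc, ∑ κ₂ : Fin (3 + 1), ∑ e₂ ∈ offs Lc,
          symHessKerAt (ctr 4 Lc) Lc ρ' w (κ₁, (Lc : ℤ) • w + e₁) (κ₂, (Lc : ℤ) • w + e₂)
            • Matrix.vecMulVec
                (fun f : ↥(pbox M) × Fin (3 + 1) => ∑' n : Site (3 + 1), symLinKerAt (ctr 4 Lc) Lc κ₁ ((Lc : ℤ) • w + e₁) (f.2, translate M (f.1 : Site (3 + 1)) n))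
                (fun f : ↥(pbox M) × Fin (3 + 1) => ∑' n : Site (3 + 1), symLinKerAt (ctr 4 Lc) Lc κ₂ ((Lc : ℤ) • w + e₂) (f.2, translate M (f.1 : Site (3 + 1)) n)))
        + ∑ κ : Fin (3 + 1), ∑ e ∈ offs Lc, symLinKerAt (ctr 4 Lc) Lc ρ' w (κ, (Lc : ℤ) • w + e)
            • (perF M (dper M (symHessFFAt (ctr 4 Lc) Lc κ ((Lc : ℤ) • w + e)))).submatrix
                (fun b : ↥(pbox M) × Fin (3 + 1) => ((b.1, Sum.inl b.2) : Idx M (Fib 3)))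
                (fun b : ↥(pbox M) × Fin (3 + 1) => ((b.1, Sum.inl b.2) : Idx M (Fib 3))) := by
  have hLc : 1 ≤ Lc := one_le_of_neZero Lc
  rw [show (2 : ℕ) = 1 + 1 from rfl, perF_dper_compH_succ_ff M 1 ρ' w]
  simp only [compLinKer_one (symLin_off (Lc := Lc)), compH_one (ctrOff_mem_box (d := 3 + 1) hLc)]
  rfl

end Split

end Summit.QuantumFields.BalabanUV.Beta.CombHessStoreySplitTorus

end
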